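import Literature.Analysis.FluidPDE.PeriodicCylinderSmoothHelmholtz
import Literature.Analysis.FluidPDE.PeriodicCylinderNeumannEstimateAll
import Literature.Analysis.FunctionSpaces.SobolevExtensionGlue
import HarnessLib

/-!
# `H^k` bounds for the smooth Helmholtz–Leray decomposition on the periodic cylinder

Topic `Literature/Analysis/FluidPDE`. Support file (all results proved, no definitions, no named
facts). For a smooth `L`-periodic field `w` on the closed cylinder `{r ≤ 1}`, the Helmholtz projection
is `Q w = ∇_K q̂` with `q̂` smooth periodic, and `P w = w − ∇_K q̂` is smooth periodic, divergence
free and tangential (`exists_smooth_leray_decomposition`, `PeriodicCylinderSmoothHelmholtz`). Here the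
classical Neumann problem solved by `q̂` is read off (`Δ_K q̂ = div w` in the open cylinder,
`∂q̂/∂n = ⟪w, x_h⟫` on the wall, from `div (P w) = 0` and `⟪P w, e_r⟫ = 0`), and the all-order
Neumann estimate (`periodicCylinder_neumannEstimate_all`, `PeriodicCylinderNeumannEstimateAll`) gives

  `‖Q w‖_{H^{N+1}(cell)} + ‖P w‖_{H^{N+1}(cell)} ≤ C ‖w‖_{H^{N+1}(cell)}`  (every `N`)

(`exists_helmholtz_leray_bound`) — T. Kato, C. Y. Lai, J. Funct. Anal. 56 (1984) §4 (i): "`P` maps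
`H^s` onto `H^s_σ` continuously … `P` and `Q = 1 − P` are bounded operators on `H^s`", the linear
input of the `H^s` theory of the Euler equations in the periodic cylinder (named fact
`Literature.Analysis.FluidPDE.KatoLai1984_periodicCylinderUniformExistence`). The Sobolev bookkeeping:
`‖div w‖_{H^N} ≤ C‖w‖_{H^{N+1}}` (`eSobolevDomainNorm_divergence_le`), `‖⟪w, x_h⟫‖_{H^k} ≤ C‖w‖_{H^k}`
(coordinate multipliers through the tree's Leibniz rule `exists_eSobolevDomainNorm_smul_le` with a bump
equal to `1` on the closed cell, components through `eSobolevDomainNorm_clm_comp_le`). Folklore calculus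
given the cited inputs.

Mathlib/tree search: `exists_eSobolevDomainNorm_smul_le` (SobolevExtensionGlue),
`eSobolevDomainNorm_clm_comp_le`, `eSobolevDomainNorm_add_le`, `eSobolevDomainNorm_fderiv_basis_le_succ`,
`ContDiffBump`; nothing on `P`/`Q` in Sobolev norms on the cylinder (`lean search 'helmholtzProj.*eSobolev'`).

## References

* T. Kato, C. Y. Lai, J. Funct. Anal. 56 (1984) 15–28, §4 (i). [KatoLai1984]
-/

noncomputable section

open MeasureTheory Set Function Filter Topology TopologicalSpace WithLp Metric Module
open scoped ContDiff NNReal ENNReal InnerProductSpace RealInnerProductSpace Laplacian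

namespace Literature.Analysis.FluidPDE

open Literature.Analysis.FunctionSpaces

/-- Local notation for physical space `ℝ³ = EuclideanSpace ℝ (Fin 3)`. -/
local notation "ℝ³" => EuclideanSpace ℝ (Fin 3)

/-- Local notation for the closed unit cylinder `{r ≤ 1}`. -/
local notation "𝕂" => closure (SetLike.coe unitCylinder : Set (EuclideanSpace ℝ (Fin 3)))

namespace PeriodicCylinder

variable {L : ℝ}

/-! ### Sobolev bookkeeping on the open cell -/

section Sobolev

variable {F : Type*} [NormedAddCommGroup F] [NormedSpace ℝ F] [CompleteSpace F]

/-- Scalar multiples: `‖c • f‖_{W^{k,2}(cell)} ≤ |c| ‖f‖_{W^{k,2}(cell)}` for `f` smooth on the open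
cell. [folklore] -/
theorem eSobolevDomainNorm_const_smul_le (k : ℕ) (c : ℝ) {f : ℝ³ → F}
    (hf : ContDiffOn ℝ ∞ f (cylinderCell L : Set ℝ³)) :
    eSobolevDomainNorm k 2 (cylinderCell L) volume (fun x => c • f x) ≤
      ‖c‖₊ * eSobolevDomainNorm k 2 (cylinderCell L) volume f := by
  have h := eSobolevDomainNorm_clm_comp_le (Ω := cylinderCell L) (p := 2) (μ := volume)
    (c • ContinuousLinearMap.id ℝ F) k hf
  simp only [_root_.FunLike.coe_smul, Pi.smul_apply, ContinuousLinearMap.id_apply] at h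
  refine h.trans (mul_le_mul' ?_ le_rfl)
  exact_mod_cast (norm_smul_le c (ContinuousLinearMap.id ℝ F)).trans
    (mul_le_of_le_one_right (norm_nonneg _) ContinuousLinearMap.norm_id_le)

/-- Finite sums: `‖Σᵢ fᵢ‖_{W^{k,2}(cell)} ≤ Σᵢ ‖fᵢ‖` for `fᵢ` smooth on the open cell. [folklore] -/
theorem eSobolevDomainNorm_finset_sum_le (k : ℕ) {ι' : Type*} (s : Finset ι') {f : ι' → ℝ³ → F}
    (hf : ∀ i ∈ s, ContDiffOn ℝ ∞ (f i) (cylinderCell L : Set ℝ³)) :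
    eSobolevDomainNorm k 2 (cylinderCell L) volume (fun x => ∑ i ∈ s, f i x) ≤
      ∑ i ∈ s, eSobolevDomainNorm k 2 (cylinderCell L) volume (f i) := by
  classical
  induction s using Finset.induction_on with
  | empty =>
    have h := eSobolevDomainNorm_clm_comp_le (Ω := cylinderCell L) (p := 2) (μ := volume) (0 : F →L[ℝ] F) k
      (contDiffOn_const (c := (0 : F)))
    simp only [_root_.zero_apply, nnnorm_zero, ENNReal.coe_zero, zero_mul, nonpos_iff_eq_zero] at h
    simp only [Finset.sum_empty]
    exact le_of_eq h
  | insert a s ha ih =>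
    have hfa := hf a (Finset.mem_insert_self a s)
    have hfs : ∀ i ∈ s, ContDiffOn ℝ ∞ (f i) (cylinderCell L : Set ℝ³) := fun i hi => hf i (Finset.mem_insert_of_mem hi)
    simp only [Finset.sum_insert ha]
    have hm1 : AEStronglyMeasurable (f a) (volume.restrict (cylinderCell L : Set ℝ³)) :=
      hfa.continuousOn.aestronglyMeasurable (cylinderCell L).isOpen.measurableSet
    have hm2 : AEStronglyMeasurable (fun x => ∑ i ∈ s, f i x) (volume.restrict (cylinderCell L : Set ℝ³)) :=
      (continuousOn_finsetSum _ fun i hi => (hfs i hi).continuousOn).aestronglyMeasurable (cylinderCell L).isOpen.measurableSet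
    have h := SobolevApprox.eSobolevDomainNorm_add_le (Ω := cylinderCell L) (p := 2) (μ := volume) (k := k) hm1 hm2 one_le_two
    exact h.trans (add_le_add le_rfl (ih hfs))

/-- **A derivative in an arbitrary direction costs one order**: `‖x ↦ Dw(x) v‖_{W^{k,2}(cell)} ≤ C ‖w‖_{W^{k+1,2}(cell)}`
with `C = Σ_j |v_j|` the coordinates of `v` in the basis of the norm. [folklore] -/
theorem eSobolevDomainNorm_fderiv_apply_le (k : ℕ) (v : ℝ³) {w : ℝ³ → F}
    (hw : ContDiffOn ℝ ∞ w (cylinderCell L : Set ℝ³)) :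
    eSobolevDomainNorm k 2 (cylinderCell L) volume (fun x => fderiv ℝ w x v) ≤
      (∑ j, ‖(finBasis ℝ ℝ³).repr v j‖₊) * eSobolevDomainNorm (k + 1) 2 (cylinderCell L) volume w := by
  set b := finBasis ℝ ℝ³ with hb
  have hv : v = ∑ j, b.repr v j • b j := (b.sum_repr v).symm
  have hterm : ∀ j, ContDiffOn ℝ ∞ (fun x => b.repr v j • fderiv ℝ w x (b j)) (cylinderCell L : Set ℝ³) := fun j =>
    ((hw.fderiv_of_isOpen (cylinderCell L).isOpen (by simp)).clm_apply contDiffOn_const).const_smul _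
  have e1 : (fun x => fderiv ℝ w x v) = fun x => ∑ j, b.repr v j • fderiv ℝ w x (b j) := by
    funext x
    conv_lhs => rw [hv]
    rw [map_sum]
    exact Finset.sum_congr rfl fun j _ => by rw [map_smul]
  rw [e1]
  refine (eSobolevDomainNorm_finset_sum_le k _ fun j _ => hterm j).trans ?_
  rw [ENNReal.ofNNReal_finsetSum, Finset.sum_mul]
  refine Finset.sum_le_sum fun j _ => ?_
  refine (eSobolevDomainNorm_const_smul_le k _ ((hw.fderiv_of_isOpen (cylinderCell L).isOpen (by simp)).clm_apply
    contDiffOn_const)).trans ?_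
  exact mul_le_mul' le_rfl (eSobolevDomainNorm_fderiv_basis_le_succ (μ := volume) 2 k j hw)

/-- **The divergence costs one order**: `‖div w‖_{W^{k,2}(cell)} ≤ C ‖w‖_{W^{k+1,2}(cell)}` for `w` smooth
on the open cell. [folklore] -/
theorem eSobolevDomainNorm_divergence_le (L : ℝ) (k : ℕ) : ∃ C : ℝ≥0, ∀ {w : ℝ³ → ℝ³},
    ContDiffOn ℝ ∞ w (cylinderCell L : Set ℝ³) →
      eSobolevDomainNorm k 2 (cylinderCell L) volume (VectorCalculus.divergence w) ≤
        C * eSobolevDomainNorm (k + 1) 2 (cylinderCell L) volume w := by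
  set e := EuclideanSpace.basisFun (Fin 3) ℝ with he
  refine ⟨∑ i : Fin 3, ‖innerSL ℝ (e i : ℝ³)‖₊ * ∑ j, ‖(finBasis ℝ ℝ³).repr (e i : ℝ³) j‖₊, fun {w} hw => ?_⟩
  have hdw : ∀ i, ContDiffOn ℝ ∞ (fun x => fderiv ℝ w x (e i)) (cylinderCell L : Set ℝ³) := fun i =>
    (hw.fderiv_of_isOpen (cylinderCell L).isOpen (by simp)).clm_apply contDiffOn_const
  have hterm : ∀ i, ContDiffOn ℝ ∞ (fun x => ⟪(e i : ℝ³), fderiv ℝ w x (e i)⟫) (cylinderCell L : Set ℝ³) := fun i =>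
    contDiffOn_const.inner ℝ (hdw i)
  have ediv : VectorCalculus.divergence w = fun x => ∑ i, ⟪(e i : ℝ³), fderiv ℝ w x (e i)⟫ :=
    funext fun x => divergence_eq_sum_inner_fderiv e w x
  rw [ediv]
  refine (eSobolevDomainNorm_finset_sum_le k _ fun i _ => hterm i).trans ?_
  rw [ENNReal.ofNNReal_finsetSum, Finset.sum_mul]
  refine Finset.sum_le_sum fun i _ => ?_
  have h1 := eSobolevDomainNorm_clm_comp_le (Ω := cylinderCell L) (p := 2) (μ := volume) (innerSL ℝ (e i : ℝ³)) k (hdw i)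
  simp only [innerSL_apply_apply] at h1
  refine h1.trans ?_
  rw [ENNReal.coe_mul, mul_assoc]
  exact mul_le_mul' le_rfl (eSobolevDomainNorm_fderiv_apply_le k _ hw)

/-- **Coordinate multipliers are bounded**: `‖x ↦ x_j f(x)‖_{W^{k,2}(cell)} ≤ A ‖f‖_{W^{k,2}(cell)}` for
`f` smooth on the closed cylinder (the tree's Leibniz rule with a bump equal to `1` on the closed
cell). [folklore] -/
theorem exists_eSobolevDomainNorm_coord_smul_le (L : ℝ) (k : ℕ) (j : Fin 3) : ∃ A : ℝ≥0,
    ∀ {f : ℝ³ → F}, ContDiffOn ℝ ∞ f 𝕂 →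
      eSobolevDomainNorm k 2 (cylinderCell L) volume (fun x : ℝ³ => (x j) • f x) ≤
        A * eSobolevDomainNorm k 2 (cylinderCell L) volume f := by
  -- a bump `= 1` on the closed cell
  obtain ⟨R, hR0, hR⟩ : ∃ R : ℝ, 0 < R ∧ closure (cylinderCell L : Set ℝ³) ⊆ ball (0 : ℝ³) R := by
    obtain ⟨R, hR⟩ := (isCompact_closure_cylinderCell (L := L)).isBounded.subset_ball_lt 0 0
    exact ⟨R, hR.1, hR.2⟩
  set χ : ContDiffBump (0 : ℝ³) := ⟨R, R + 1, hR0, by linarith⟩ with hχ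
  set ζ : ℝ³ → ℝ := fun x => χ x * x j with hζ
  have hζs : ContDiff ℝ ∞ ζ := χ.contDiff.mul (contDiff_cylCoordFun j)
  have hζc : HasCompactSupport ζ := χ.hasCompactSupport.mul_right
  obtain ⟨A, hA⟩ := exists_eSobolevDomainNorm_smul_le (E' := ℝ³) (F := F) k hζs hζc
  refine ⟨A, fun {f} hf => ?_⟩
  have hmem : MemSobolevDomain k 2 (cylinderCell L) volume f :=
    memSobolevDomain_of_contDiffOn (μ := volume) uniqueDiffOn_closure_unitCylinder (isCompact_closure_cylinderCell (L := L))
      closure_cylinderCell_subset_K 2 k hf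
  obtain ⟨-, hbound⟩ := hA 2 (cylinderCell L) volume f one_le_two hmem
  have heq : EqOn (fun x : ℝ³ => (x j) • f x) (fun x => ζ x • f x) (cylinderCell L : Set ℝ³) := fun x hx => by
    have hxb : x ∈ closedBall (0 : ℝ³) R := ball_subset_closedBall (hR (subset_closure hx))
    simp only [hζ, χ.one_of_mem_closedBall hxb, one_mul]
  rw [SobolevApprox.eSobolevDomainNorm_congr (Ω := cylinderCell L) (p := 2) (μ := volume) heq]
  exact hbound

/-- **`⟪w, x_h⟫` is bounded by `w` in every `W^{k,2}(cell)`** for `w` smooth on the closed cylinder.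
[folklore] -/
theorem exists_eSobolevDomainNorm_inner_horizontalProj_le (L : ℝ) (k : ℕ) : ∃ A : ℝ≥0,
    ∀ {w : ℝ³ → ℝ³}, ContDiffOn ℝ ∞ w 𝕂 →
      eSobolevDomainNorm k 2 (cylinderCell L) volume (fun x => ⟪w x, horizontalProj x⟫) ≤
        A * eSobolevDomainNorm k 2 (cylinderCell L) volume w := by
  obtain ⟨A₀, hA₀⟩ := exists_eSobolevDomainNorm_coord_smul_le (F := ℝ) L k 0
  obtain ⟨A₁, hA₁⟩ := exists_eSobolevDomainNorm_coord_smul_le (F := ℝ) L k 1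
  set P0 : ℝ³ →L[ℝ] ℝ := EuclideanSpace.proj (0 : Fin 3) with hP0
  set P1 : ℝ³ →L[ℝ] ℝ := EuclideanSpace.proj (1 : Fin 3) with hP1
  refine ⟨A₀ * ‖P0‖₊ + A₁ * ‖P1‖₊, fun {w} hw => ?_⟩
  have hw0 : ContDiffOn ℝ ∞ (fun x => P0 (w x)) 𝕂 := P0.contDiff.comp_contDiffOn hw
  have hw1 : ContDiffOn ℝ ∞ (fun x => P1 (w x)) 𝕂 := P1.contDiff.comp_contDiffOn hw
  have hcell : (cylinderCell L : Set ℝ³) ⊆ 𝕂 := fun x hx => subset_closure (cylinderCell_le_unitCylinder L hx)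
  have e1 : (fun x => ⟪w x, horizontalProj x⟫) = fun x : ℝ³ => (x 0) • P0 (w x) + (x 1) • P1 (w x) := by
    funext x
    simp only [hP0, hP1, horizontalProj_apply_eq, PiLp.inner_apply, Fin.sum_univ_three, RCLike.inner_apply, conj_trivial,
      smul_eq_mul]
    simp [EuclideanSpace.proj]
  rw [e1]
  have hm0 : AEStronglyMeasurable (fun x : ℝ³ => (x 0) • P0 (w x)) (volume.restrict (cylinderCell L : Set ℝ³)) :=
    (((contDiff_cylCoordFun 0).contDiffOn.smul hw0).continuousOn.mono hcell).aestronglyMeasurable (cylinderCell L).isOpen.measurableSet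
  have hm1 : AEStronglyMeasurable (fun x : ℝ³ => (x 1) • P1 (w x)) (volume.restrict (cylinderCell L : Set ℝ³)) :=
    (((contDiff_cylCoordFun 1).contDiffOn.smul hw1).continuousOn.mono hcell).aestronglyMeasurable (cylinderCell L).isOpen.measurableSet
  refine (SobolevApprox.eSobolevDomainNorm_add_le (Ω := cylinderCell L) (p := 2) (μ := volume) (k := k) hm0 hm1 one_le_two).trans ?_
  rw [ENNReal.coe_add, ENNReal.coe_mul, ENNReal.coe_mul, add_mul]
  refine add_le_add ((hA₀ hw0).trans ?_) ((hA₁ hw1).trans ?_)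
  · rw [mul_assoc]
    exact mul_le_mul' le_rfl (eSobolevDomainNorm_clm_comp_le (Ω := cylinderCell L) (p := 2) (μ := volume) P0 k (hw.mono hcell))
  · rw [mul_assoc]
    exact mul_le_mul' le_rfl (eSobolevDomainNorm_clm_comp_le (Ω := cylinderCell L) (p := 2) (μ := volume) P1 k (hw.mono hcell))

end Sobolev

/-! ### The classical Neumann problem of the Helmholtz potential -/

/-- The divergence of a difference of fields differentiable at the point. [folklore] -/
theorem divergence_sub_apply {u v : ℝ³ → ℝ³} {x : ℝ³} (hu : DifferentiableAt ℝ u x) (hv : DifferentiableAt ℝ v x) :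
    VectorCalculus.divergence (fun y => u y - v y) x = VectorCalculus.divergence u x - VectorCalculus.divergence v x := by
  unfold VectorCalculus.divergence
  rw [fderiv_fun_sub hu hv, ContinuousLinearMap.toLinearMap_sub, map_sub]

/-- On the open cylinder `div (∇_K q) = Δ_K q` for `q` smooth on the closed cylinder. [folklore] -/
theorem divergence_cylGrad_eq_cylLap {q : ℝ³ → ℝ} (hq : ContDiffOn ℝ ∞ q 𝕂) {x : ℝ³}
    (hx : x ∈ (unitCylinder : Set ℝ³)) : VectorCalculus.divergence (cylGrad q) x = cylLap q x := by
  have hev : cylGrad q =ᶠ[𝓝 x] gradient q :=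
    Filter.eventuallyEq_of_mem (unitCylinder.isOpen.mem_nhds hx) fun y hy => cylGrad_eq_gradient q hy
  unfold VectorCalculus.divergence
  rw [hev.fderiv_eq]
  exact divergence_gradient_eq_cylLap hq hx

/-- **The potential of the smooth Helmholtz decomposition solves the classical Neumann problem**:
if `w − ∇_K q̂` is divergence free in the open cylinder and tangential on the wall then
`Δ_K q̂ = div w` in the open cylinder and `∂q̂/∂n = ⟪w, x_h⟫` on the wall. [folklore] -/
theorem neumann_of_leray {w : ℝ³ → ℝ³} {qhat : ℝ³ → ℝ} (hw : IsSmoothPeriodic L w) (hq : IsSmoothPeriodic L qhat)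
    (hdiv : ∀ x ∈ (unitCylinder : Set ℝ³), VectorCalculus.divergence (fun y => w y - cylGrad qhat y) x = 0)
    (hslip : ∀ x ∈ frontier (unitCylinder : Set ℝ³), ⟪w x - cylGrad qhat x, eR x⟫ = 0) :
    (∀ x ∈ (unitCylinder : Set ℝ³), cylLap qhat x = VectorCalculus.divergence w x) ∧
    (∀ x ∈ frontier (unitCylinder : Set ℝ³), fderivWithin ℝ qhat 𝕂 x (eR x) = ⟪w x, horizontalProj x⟫) := by
  constructor
  · intro x hx
    have hxr : cylRadius x < 1 := hx
    have hwd : DifferentiableAt ℝ w x := differentiableAt_of_contDiffOn_closure (hw.smooth.of_le (by exact_mod_cast le_top)) hxr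
    have hgd : DifferentiableAt ℝ (cylGrad qhat) x :=
      differentiableAt_of_contDiffOn_closure ((contDiffOn_cylGrad hq.smooth).of_le (by exact_mod_cast le_top)) hxr
    have h := hdiv x hx
    rw [divergence_sub_apply hwd hgd, divergence_cylGrad_eq_cylLap hq.smooth hx, sub_eq_zero] at h
    exact h.symm
  · intro x hx
    have h := hslip x hx
    rw [inner_sub_left, sub_eq_zero] at h
    rw [← inner_cylGrad_right, real_inner_comm, ← h, eR_eq_horizontalProj_of_wall hx]

/-! ### The bound -/

/-- **`H^k` bounds for the smooth Helmholtz–Leray decomposition** (Kato–Lai 1984 §4 (i): `P` and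
`Q = 1 − P` are bounded on `H^s`): for `L > 0` and every `N` there is `C` such that for every smooth
`L`-periodic field `w` the decomposition `w = P w + ∇_K q̂` of `exists_smooth_leray_decomposition` has
`‖∇_K q̂‖_{H^{N+1}(cell)} ≤ C ‖w‖_{H^{N+1}(cell)}` and `‖P w‖_{H^{N+1}(cell)} ≤ (1 + C) ‖w‖_{H^{N+1}(cell)}`.
[folklore] -/
theorem exists_helmholtz_leray_bound (hL : 0 < L) (N : ℕ) : ∃ C : ℝ≥0, ∀ {w : ℝ³ → ℝ³}, IsSmoothPeriodic L w →
    ∃ qhat : ℝ³ → ℝ, IsSmoothPeriodic L qhat ∧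
      helmholtzProj L (toCell L w) = toCell L (cylGrad qhat) ∧
      lerayProj L (toCell L w) = toCell L (fun x => w x - cylGrad qhat x) ∧
      IsSmoothPeriodic L (fun x => w x - cylGrad qhat x) ∧
      (∀ x ∈ (unitCylinder : Set ℝ³), VectorCalculus.divergence (fun y => w y - cylGrad qhat y) x = 0) ∧
      (∀ x ∈ frontier (unitCylinder : Set ℝ³), ⟪w x - cylGrad qhat x, eR x⟫ = 0) ∧
      eSobolevDomainNorm (N + 1) 2 (cylinderCell L) volume (cylGrad qhat) ≤
        C * eSobolevDomainNorm (N + 1) 2 (cylinderCell L) volume w ∧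
      eSobolevDomainNorm (N + 1) 2 (cylinderCell L) volume (fun x => w x - cylGrad qhat x) ≤
        (1 + C) * eSobolevDomainNorm (N + 1) 2 (cylinderCell L) volume w := by
  obtain ⟨C₀, hC₀⟩ := periodicCylinder_neumannEstimate_all L hL N
  obtain ⟨Cd, hCd⟩ := eSobolevDomainNorm_divergence_le L N
  obtain ⟨Cg, hCg⟩ := exists_eSobolevDomainNorm_inner_horizontalProj_le L (N + 1)
  refine ⟨C₀ * (Cd + Cg), fun {w} hw => ?_⟩
  obtain ⟨qhat, hqs, hQ, hP, hPw, hdiv, hslip⟩ := exists_smooth_leray_decomposition hL hw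
  obtain ⟨hlap, hneu⟩ := neumann_of_leray hw hqs hdiv hslip
  have hcell : (cylinderCell L : Set ℝ³) ⊆ 𝕂 := fun x hx => subset_closure (cylinderCell_le_unitCylinder L hx)
  -- the Neumann datum
  have hGs : IsSmoothPeriodic L fun x => ⟪w x, horizontalProj x⟫ :=
    ⟨ContDiffOn.inner ℝ hw.smooth contDiff_horizontalProj.contDiffOn, fun x => by
      simp only [hw.periodic x, horizontalProj_add_axialShift]⟩
  have hmain := hC₀ qhat (fun x => ⟪w x, horizontalProj x⟫) hqs.smooth hGs.smooth hqs.periodic hGs.periodic hneu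
  -- the Laplacian is the divergence of `w` on the cell
  have hΔ : eSobolevDomainNorm N 2 (cylinderCell L) volume (Δ qhat) =
      eSobolevDomainNorm N 2 (cylinderCell L) volume (VectorCalculus.divergence w) := by
    rw [eSobolevDomainNorm_laplacian_eq_cylLap L N hqs.smooth]
    exact SobolevApprox.eSobolevDomainNorm_congr (Ω := cylinderCell L) (p := 2) (μ := volume) fun x hx =>
      hlap x (cylinderCell_le_unitCylinder L hx)
  have hQbound : eSobolevDomainNorm (N + 1) 2 (cylinderCell L) volume (cylGrad qhat) ≤
      (C₀ * (Cd + Cg) : ℝ≥0) * eSobolevDomainNorm (N + 1) 2 (cylinderCell L) volume w := by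
    rw [← eSobolevDomainNorm_gradient_eq_cylGrad L (N + 1) hqs.smooth]
    refine hmain.trans ?_
    rw [hΔ, ENNReal.coe_mul, ENNReal.coe_add, mul_assoc, add_mul]
    exact mul_le_mul' le_rfl (add_le_add (hCd (hw.smooth.mono hcell)) (hCg hw.smooth))
  refine ⟨qhat, hqs, hQ, hP, hPw, hdiv, hslip, hQbound, ?_⟩
  -- `P w = w + (−1) • ∇_K q̂`
  have hm1 : AEStronglyMeasurable w (volume.restrict (cylinderCell L : Set ℝ³)) :=
    (hw.continuousOn.mono hcell).aestronglyMeasurable (cylinderCell L).isOpen.measurableSet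
  have hm2 : AEStronglyMeasurable (fun x => (-1 : ℝ) • cylGrad qhat x) (volume.restrict (cylinderCell L : Set ℝ³)) :=
    ((hqs.cylGrad.continuousOn.mono hcell).aestronglyMeasurable (cylinderCell L).isOpen.measurableSet).const_smul (-1 : ℝ)
  have e1 : (fun x => w x - cylGrad qhat x) = fun x => w x + (-1 : ℝ) • cylGrad qhat x := by
    funext x; rw [neg_one_smul, sub_eq_add_neg]
  rw [e1]
  refine (SobolevApprox.eSobolevDomainNorm_add_le (Ω := cylinderCell L) (p := 2) (μ := volume) (k := N + 1) hm1 hm2 one_le_two).trans ?_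
  rw [add_mul, one_mul]
  refine add_le_add le_rfl ?_
  refine (eSobolevDomainNorm_const_smul_le (N + 1) (-1 : ℝ) ((contDiffOn_cylGrad hqs.smooth).mono hcell)).trans ?_
  rw [nnnorm_neg, nnnorm_one, ENNReal.coe_one, one_mul]
  exact hQbound

end PeriodicCylinder

end Literature.Analysis.FluidPDE
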